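import Summits.QuantumFields.YangMills.Theorems.VirialFluxGapRegularValleyLocalise
import Summits.QuantumFields.YangMills.Theorems.FlatTubeReductionPolyakovPairSeparation
import HarnessLib

/-!
# Route `VirialFluxGap` (YangMills): PROPAGATION OF REGULARITY along the toron valley — the comb holonomies are `7L`-Lipschitz in the links,
# so `regular_linear_localise` holds on a whole tube around a regular toron

Companion of ✓`RegularValley.regular_linear_localise` ∕ ✓`exists_central_flat_ring_near_of_central` (crux ⟨stmt-QuantumFields-24141⟩
`VirialFluxGap.PeriodicSoftness`; the regular ∕ central dichotomy is stated on the four COMB HOLONOMIES of a ring history: the three wrap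
representatives `wrapReps(P₀)` of slice `0` in comb gauge and the seam value `P.2 0`).  To use the regular chart on a TUBE around a regular
toron `Q` one needs the comb holonomies of every nearby `P` to stay regular:

* `fd_treeGauge_le` — the comb transporter is Lipschitz: `‖treeGauge U x − treeGauge V x‖_F ≤ 3L·m` if every link of `U` is within `m` of the
  corresponding link of `V` (✓`frobNorm_lineProd_sub_lineProd_le` on the three legs);  `fd_treeFix_le` — `‖treeFix U e − treeFix V e‖_F ≤ 7L·m`;
  `fd_wrapReps_le` — the same for the wrap representatives;
* `imDot_ge_of_norm_sub_le` — quaternion bookkeeping: `|Im b|² ≥ ρ²`, `‖a − b‖ ≤ τ`, `2τ ≤ ρ` ⟹ `|Im a|² ≥ (ρ/2)²` (written on `1 − re²` for units);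
* ★★ `regular_of_near_regular` — if `Q` has a `ρ`-regular comb holonomy (`1 − re(q)² ≥ ρ²` for some wrap representative or the seam value) and
  every slice-`0` link and the seam value at `0` of `P` are within `m` of those of `Q` with `28L·m ≤ ρ`, then `P` has a `ρ/2`-regular comb holonomy;
  ★★ `regular_linear_localise_of_near_regular` — hence `dist(P, {F₀ = 0}) ≤ 4·21520·L⁸·F₀(P)/ρ²` for every such `P` (quadratic growth on the tube).

HONEST FRAMING: lattice bookkeeping; the Euler field, ⟨24141⟩, every rung and the Yang–Mills mass gap remain OPEN; no summit is proved by a line.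
ROUTE-INDEPENDENT.  THEOREMS ONLY (no definition, no `sorry`), standard axioms.  Width seat `ym-line-sfw-p2-w2` g51 (cell ym-idea-1, free hands),
`--supports stmt-QuantumFields-24141`.  References: [cite: Luscher1983, §2]; [cite: SeilerLNP1982, §2].
-/

set_option autoImplicit false

noncomputable section

open scoped Quaternion Matrix BigOperators
open Literature.MathematicalPhysics.QuantumFieldTheory hiding SU2
open Literature.MathematicalPhysics.QuantumLattice

namespace Summit.QuantumFields.YangMills.Theorems.VirialFluxGap.RegularValley

open Summit.QuantumFields.YangMills.Theorems.FemtoTransferGap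
open Summit.QuantumFields.YangMills.Theorems.FemtoTransferGap.TT
open Summit.QuantumFields.YangMills.Theorems.FemtoTransferGap.TwoLattice
open Summit.QuantumFields.YangMills.Theorems.FemtoTransferGap.TwoLattice.Flat
open Summit.QuantumFields.YangMills.Theorems.FemtoTransferGap.TwoLattice.Cov
open Summit.QuantumFields.YangMills.Theorems.FemtoTransferGap.TwoLattice.ConstTube (frobNorm_lineProd_sub_lineProd_le)
open Summit.QuantumFields.YangMills.Theorems.VirialFluxGap.RingDeficit
open Summit.QuantumFields.YangMills.Theorems.ToronValleyVolume.Lojasiewicz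

variable {L : ℕ} [NeZero L]

/-! ## §1 The comb transporter is Lipschitz in the links -/

omit [NeZero L] in
/-- A Polyakov segment of `n` links is `n·m`-close when the links are `m`-close. [folklore] -/
theorem fd_lineProd_le {U V : GaugeConfig 3 L SU2} {m : ℝ} (hUV : ∀ e, fd (U e) (V e) ≤ m) (x : Site 3 L) (k : Fin 3) (n : ℕ) :
    fd (lineProd U x k n) (lineProd V x k n) ≤ n * m := by
  unfold fd
  refine (frobNorm_lineProd_sub_lineProd_le U V x k n).trans ?_
  calc ∑ j ∈ Finset.range n, frobNorm (((U (x + (Pi.single k ((j : ℕ) : ZMod L) : Site 3 L), k) : SU2) : Matrix (Fin 2) (Fin 2) ℂ) -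
          ((V (x + (Pi.single k ((j : ℕ) : ZMod L) : Site 3 L), k) : SU2) : Matrix (Fin 2) (Fin 2) ℂ))
      ≤ ∑ _j ∈ Finset.range n, m := Finset.sum_le_sum fun j _ => hUV _
    _ = n * m := by rw [Finset.sum_const, Finset.card_range, nsmul_eq_mul]

/-- ★ **The comb transporter is `3L`-Lipschitz**: `‖treeGauge U x − treeGauge V x‖_F ≤ 3L·m`. [cite: SeilerLNP1982, §2] -/
theorem fd_treeGauge_le {U V : GaugeConfig 3 L SU2} {m : ℝ} (hm : 0 ≤ m) (hUV : ∀ e, fd (U e) (V e) ≤ m) (x : Site 3 L) :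
    fd (treeGauge U x) (treeGauge V x) ≤ 3 * (L : ℝ) * m := by
  have hval : ∀ k : Fin 3, ((x k).val : ℝ) ≤ L := fun k => by exact_mod_cast (ZMod.val_lt (x k)).le
  have h0 : fd (lineProd U 0 0 (x 0).val) (lineProd V 0 0 (x 0).val) ≤ (x 0).val * m := fd_lineProd_le hUV 0 0 (x 0).val
  have h1 : fd (lineProd U (base1 x) 1 (x 1).val) (lineProd V (base1 x) 1 (x 1).val) ≤ (x 1).val * m := fd_lineProd_le hUV _ 1 _
  have h2 : fd (lineProd U (base2 x) 2 (x 2).val) (lineProd V (base2 x) 2 (x 2).val) ≤ (x 2).val * m := fd_lineProd_le hUV _ 2 _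
  have hmul : ∀ (A B A' B' : SU2), fd (A * B) (A' * B') ≤ fd A A' + fd B B' := fun A B A' B' => by
    unfold fd; exact frobNorm_mul_sub_mul_le A B A' B'
  have hdef : treeGauge U x = lineProd U 0 0 (x 0).val * lineProd U (base1 x) 1 (x 1).val * lineProd U (base2 x) 2 (x 2).val := rfl
  have hdef' : treeGauge V x = lineProd V 0 0 (x 0).val * lineProd V (base1 x) 1 (x 1).val * lineProd V (base2 x) 2 (x 2).val := rfl
  rw [hdef, hdef']
  have step1 := hmul (lineProd U 0 0 (x 0).val * lineProd U (base1 x) 1 (x 1).val) (lineProd U (base2 x) 2 (x 2).val)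
    (lineProd V 0 0 (x 0).val * lineProd V (base1 x) 1 (x 1).val) (lineProd V (base2 x) 2 (x 2).val)
  have step2 := hmul (lineProd U 0 0 (x 0).val) (lineProd U (base1 x) 1 (x 1).val) (lineProd V 0 0 (x 0).val) (lineProd V (base1 x) 1 (x 1).val)
  have e0 := mul_le_mul_of_nonneg_right (hval 0) hm
  have e1 := mul_le_mul_of_nonneg_right (hval 1) hm
  have e2 := mul_le_mul_of_nonneg_right (hval 2) hm
  linarith

/-- ★ **The comb gauge is `7L`-Lipschitz**: `‖treeFix U e − treeFix V e‖_F ≤ 7L·m`. [cite: SeilerLNP1982, §2] -/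
theorem fd_treeFix_le {U V : GaugeConfig 3 L SU2} {m : ℝ} (hm : 0 ≤ m) (hUV : ∀ e, fd (U e) (V e) ≤ m) (e : Edge 3 L) :
    fd (treeFix U e) (treeFix V e) ≤ 7 * (L : ℝ) * m := by
  have hL1 : (1 : ℝ) ≤ L := by exact_mod_cast NeZero.one_le
  have hmul : ∀ (A B A' B' : SU2), fd (A * B) (A' * B') ≤ fd A A' + fd B B' := fun A B A' B' => by
    unfold fd; exact frobNorm_mul_sub_mul_le A B A' B'
  have hdef : treeFix U e = treeGauge U e.1 * U e * (treeGauge U (e.1.shift e.2))⁻¹ := rfl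
  have hdef' : treeFix V e = treeGauge V e.1 * V e * (treeGauge V (e.1.shift e.2))⁻¹ := rfl
  rw [hdef, hdef']
  have h1 := fd_treeGauge_le hm hUV e.1
  have h2 := hUV e
  have h3 : fd (treeGauge U (e.1.shift e.2))⁻¹ (treeGauge V (e.1.shift e.2))⁻¹ ≤ 3 * (L : ℝ) * m := by
    rw [fd_inv]; exact fd_treeGauge_le hm hUV _
  have step1 := hmul (treeGauge U e.1 * U e) (treeGauge U (e.1.shift e.2))⁻¹ (treeGauge V e.1 * V e) (treeGauge V (e.1.shift e.2))⁻¹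
  have step2 := hmul (treeGauge U e.1) (U e) (treeGauge V e.1) (V e)
  have hmL : m ≤ (L : ℝ) * m := le_mul_of_one_le_left hm hL1
  linarith

/-- The wrap representatives are `7L`-Lipschitz. [cite: SeilerLNP1982, §2] -/
theorem fd_wrapReps_le {U V : GaugeConfig 3 L SU2} {m : ℝ} (hm : 0 ≤ m) (hUV : ∀ e, fd (U e) (V e) ≤ m) (k : Fin 3) :
    fd (wrapReps U k) (wrapReps V k) ≤ 7 * (L : ℝ) * m := by
  rw [wrapReps_eq, wrapReps_eq]; exact fd_treeFix_le hm hUV _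

/-! ## §2 Regularity survives a small perturbation -/

omit [NeZero L] in
/-- Quaternion bookkeeping: `1 − re(b)² ≥ ρ²`, `‖a − b‖ ≤ τ`, `2τ ≤ ρ` for units `a, b` ⟹ `1 − re(a)² ≥ (ρ/2)²` (triangle inequality for the
imaginary parts in `ℝ³`, Cauchy–Schwarz written out). [folklore] -/
theorem one_sub_re_sq_ge_of_norm_sub_le {a b : ℍ} (ha : ‖a‖ = 1) (hb : ‖b‖ = 1) {ρ τ : ℝ} (hτ : 0 ≤ τ) (hρτ : 2 * τ ≤ ρ)
    (hreg : ρ ^ 2 ≤ 1 - b.re ^ 2) (hab : ‖a - b‖ ≤ τ) : (ρ / 2) ^ 2 ≤ 1 - a.re ^ 2 := by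
  -- imaginary masses
  have hA : 1 - a.re ^ 2 = a.imI ^ 2 + a.imJ ^ 2 + a.imK ^ 2 := by
    have h := norm_sq_eq_re_sq_add_imDot a; rw [ha, one_pow, imDot_self_eq] at h; linarith
  have hB : 1 - b.re ^ 2 = b.imI ^ 2 + b.imJ ^ 2 + b.imK ^ 2 := by
    have h := norm_sq_eq_re_sq_add_imDot b; rw [hb, one_pow, imDot_self_eq] at h; linarith
  -- the imaginary part of the difference is at most `τ`
  have hD : (a.imI - b.imI) ^ 2 + (a.imJ - b.imJ) ^ 2 + (a.imK - b.imK) ^ 2 ≤ τ ^ 2 := by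
    have h := norm_sq_eq_re_sq_add_imDot (a - b)
    rw [imDot_self_eq, Quaternion.re_sub, Quaternion.imI_sub, Quaternion.imJ_sub, Quaternion.imK_sub] at h
    have h2 : ‖a - b‖ ^ 2 ≤ τ ^ 2 := pow_le_pow_left₀ (norm_nonneg _) hab 2
    nlinarith [sq_nonneg (a.re - b.re)]
  set A : ℝ := Real.sqrt (a.imI ^ 2 + a.imJ ^ 2 + a.imK ^ 2) with hAdef
  set D : ℝ := Real.sqrt ((a.imI - b.imI) ^ 2 + (a.imJ - b.imJ) ^ 2 + (a.imK - b.imK) ^ 2) with hDdef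
  have hA0 : 0 ≤ A := Real.sqrt_nonneg _
  have hD0 : 0 ≤ D := Real.sqrt_nonneg _
  have hA2 : A ^ 2 = a.imI ^ 2 + a.imJ ^ 2 + a.imK ^ 2 := Real.sq_sqrt (by positivity)
  have hD2 : D ^ 2 = (a.imI - b.imI) ^ 2 + (a.imJ - b.imJ) ^ 2 + (a.imK - b.imK) ^ 2 := Real.sq_sqrt (by positivity)
  have hDτ : D ≤ τ := by
    rw [hDdef, ← Real.sqrt_sq hτ]; exact Real.sqrt_le_sqrt hD
  -- Cauchy–Schwarz: `Σ a_i (b_i − a_i) ≤ A·D`, hence `|Im b|² ≤ (A + D)²`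
  have hCS : (a.imI * (b.imI - a.imI) + a.imJ * (b.imJ - a.imJ) + a.imK * (b.imK - a.imK)) ^ 2 ≤
      (a.imI ^ 2 + a.imJ ^ 2 + a.imK ^ 2) * ((a.imI - b.imI) ^ 2 + (a.imJ - b.imJ) ^ 2 + (a.imK - b.imK) ^ 2) := by
    nlinarith [sq_nonneg (a.imI * (b.imJ - a.imJ) - a.imJ * (b.imI - a.imI)), sq_nonneg (a.imI * (b.imK - a.imK) - a.imK * (b.imI - a.imI)),
      sq_nonneg (a.imJ * (b.imK - a.imK) - a.imK * (b.imJ - a.imJ))]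
  have hdot : a.imI * (b.imI - a.imI) + a.imJ * (b.imJ - a.imJ) + a.imK * (b.imK - a.imK) ≤ A * D := by
    have hAD : 0 ≤ A * D := mul_nonneg hA0 hD0
    have h2 : (a.imI * (b.imI - a.imI) + a.imJ * (b.imJ - a.imJ) + a.imK * (b.imK - a.imK)) ^ 2 ≤ (A * D) ^ 2 := by
      rw [mul_pow, hA2, hD2]; exact hCS
    exact abs_le_of_sq_le_sq' h2 hAD |>.2
  have hB_le : b.imI ^ 2 + b.imJ ^ 2 + b.imK ^ 2 ≤ (A + D) ^ 2 := by
    have e : b.imI ^ 2 + b.imJ ^ 2 + b.imK ^ 2 = (a.imI ^ 2 + a.imJ ^ 2 + a.imK ^ 2) +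
        2 * (a.imI * (b.imI - a.imI) + a.imJ * (b.imJ - a.imJ) + a.imK * (b.imK - a.imK)) +
        ((a.imI - b.imI) ^ 2 + (a.imJ - b.imJ) ^ 2 + (a.imK - b.imK) ^ 2) := by ring
    rw [e, ← hA2, ← hD2]; nlinarith [hdot]
  -- `ρ ≤ A + D ≤ A + τ`, so `A ≥ ρ − τ ≥ ρ/2`
  have hρ0 : 0 ≤ ρ := by linarith
  have hρAD : ρ ≤ A + D := by
    have h1 : ρ ^ 2 ≤ (A + D) ^ 2 := by rw [hB] at hreg; exact hreg.trans hB_le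
    exact (abs_le_of_sq_le_sq' h1 (by positivity)).2
  have hA_ge : ρ / 2 ≤ A := by linarith
  rw [hA, ← hA2]
  exact pow_le_pow_left₀ (by linarith) hA_ge 2

/-- ★★ **Regularity propagates**: if `Q` has a `ρ`-regular comb holonomy and every slice-`0` link and the seam value at the root of `P` are within
`m` of those of `Q` (Frobenius) with `28L·m ≤ ρ`, then `P` has a `ρ/2`-regular comb holonomy. [cite: Luscher1983, §2] -/
theorem regular_of_near_regular (P Q : (Fin (2 * L - 1 + 1) → GaugeConfig 3 L SU2) × (Site 3 L → SU2)) {ρ m : ℝ} (hm : 0 ≤ m)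
    (hPQ : ∀ e, fd (P.1 0 e) (Q.1 0 e) ≤ m) (hPQs : fd (P.2 0) (Q.2 0) ≤ m) (hsmall : 28 * (L : ℝ) * m ≤ ρ)
    (hreg : (∃ k : Fin 3, ρ ^ 2 ≤ 1 - (su2Quat (wrapReps (Q.1 0) k)).re ^ 2) ∨ ρ ^ 2 ≤ 1 - (su2Quat (Q.2 0)).re ^ 2) :
    (∃ k : Fin 3, (ρ / 2) ^ 2 ≤ 1 - (su2Quat (wrapReps (P.1 0) k)).re ^ 2) ∨ (ρ / 2) ^ 2 ≤ 1 - (su2Quat (P.2 0)).re ^ 2 := by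
  have hL1 : (1 : ℝ) ≤ L := by exact_mod_cast NeZero.one_le
  set τ : ℝ := 7 * (L : ℝ) * m with hτ
  have hτ0 : 0 ≤ τ := by positivity
  have hρτ : 2 * τ ≤ ρ := by rw [hτ]; linarith
  rcases hreg with ⟨k, hk⟩ | h0
  · refine Or.inl ⟨k, ?_⟩
    have hd : ‖su2Quat (wrapReps (P.1 0) k) - su2Quat (wrapReps (Q.1 0) k)‖ ≤ τ :=
      (norm_su2Quat_sub_le_fd _ _).trans (fd_wrapReps_le hm hPQ k)
    exact one_sub_re_sq_ge_of_norm_sub_le (norm_su2Quat _) (norm_su2Quat _) hτ0 hρτ hk hd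
  · refine Or.inr ?_
    have hd : ‖su2Quat (P.2 0) - su2Quat (Q.2 0)‖ ≤ τ := by
      refine (norm_su2Quat_sub_le_fd _ _).trans (hPQs.trans ?_)
      rw [hτ]; nlinarith
    exact one_sub_re_sq_ge_of_norm_sub_le (norm_su2Quat _) (norm_su2Quat _) hτ0 hρτ h0 hd

/-- ★★ **Quadratic growth on a tube around a regular toron**: under the hypotheses of `regular_of_near_regular`,
`dist(P, {F₀ = 0}) ≤ 4·21520·L⁸·F₀(P)/ρ²`. [cite: Luscher1983, §2] -/
theorem regular_linear_localise_of_near_regular (P Q : (Fin (2 * L - 1 + 1) → GaugeConfig 3 L SU2) × (Site 3 L → SU2)) {ρ m : ℝ}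
    (hρ : 0 < ρ) (hm : 0 ≤ m) (hPQ : ∀ e, fd (P.1 0 e) (Q.1 0 e) ≤ m) (hPQs : fd (P.2 0) (Q.2 0) ≤ m) (hsmall : 28 * (L : ℝ) * m ≤ ρ)
    (hreg : (∃ k : Fin 3, ρ ^ 2 ≤ 1 - (su2Quat (wrapReps (Q.1 0) k)).re ^ 2) ∨ ρ ^ 2 ≤ 1 - (su2Quat (Q.2 0)).re ^ 2) :
    sInf ((fun Q' : (Fin (2 * L - 1 + 1) → GaugeConfig 3 L SU2) × (Site 3 L → SU2) =>
        (∑ i : Fin (2 * L - 1 + 1), (6 * (L : ℝ) ^ 3 - timeCoupling su2Rep (P.1 i) (Q'.1 i))) +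
          ∑ x : Site 3 L, (2 - ((su2Rep (P.2 x * (Q'.2 x)⁻¹)).trace).re)) ''
        {Q' | ringDeficit L (fun _ => false) Q' = 0}) ≤
      4 * 21520 * (L : ℝ) ^ 8 * ringDeficit L (fun _ => false) P / ρ ^ 2 := by
  have h := regular_linear_localise P (by positivity : 0 < ρ / 2) (regular_of_near_regular P Q hm hPQ hPQs hsmall hreg)
  have e : 21520 * (L : ℝ) ^ 8 * ringDeficit L (fun _ => false) P / (ρ / 2) ^ 2 =
      4 * 21520 * (L : ℝ) ^ 8 * ringDeficit L (fun _ => false) P / ρ ^ 2 := by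
    field_simp; ring
  rw [e] at h
  exact h

end Summit.QuantumFields.YangMills.Theorems.VirialFluxGap.RegularValley

end
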